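import Literature.NumberTheory.EllipticCurves.HeathBrown1994.CongruentTwoSelmerMonskyMatrix
import HarnessLib

/-!
# Sub-lane «bsd-p2»: Monsky's Selmer ranks are invariant under RELABELLING the prime tuple
# (the enabling lemma of a representatives-only configuration census; typer GEN 23, T-164 scratch)

HONEST FRAMING (sub-lane «bsd-p2», run/shared/lean/b2b/bsd-rank1-residual/p2/, verbatim in every
file): the target of record is the FULL Birch–Swinnerton-Dyer formula for EVERY analytic-rank `≤ 1`
`E/ℚ` at ALL primes INCLUDING `2`; the odd-prime class ledger is referee A's; the `2`-part is OPEN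
(cells O1 = X5 ∖ CM and O12 = the CM corner) and under census by «bsd-p2». Census / instrument
output at `2` = EVIDENCE / conjecture items with held-out validation, NEVER a Literature fact;
certificates close PAIRS (one isogeny class, `p = 2`), never classes. This file asserts NO
arithmetic fact: it is linear algebra — permuting the primes `p ∘ σ` reindexes Monsky's matrices by
`σ ⊕ σ`, so their ranks, hence `s(n)`, are unchanged.

WHY. A configuration census quantifies over ORDERED tuples (`256` at `ω(m) = 3`, `8192` at `4`); with
this lemma a census over the S_k-MINIMAL representatives only (`52`, resp. `416`) transfers to every
tuple by relabelling (`∏ (p ∘ σ) = ∏ p`), which is the certificate shape a `k = 4` kernel census would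
need (memo `GEN23-EVEN-ATLAS-THREE.md`, price warning). Nothing booked; no mark moved. Unit
`b2b-bsdres-p2-typer` GEN 23; scratch (NOT proposed — rails T-149 (e) / T-155 (o)).

References: [HeathBrown1994SelmerCongruentII] Appendix (Monsky), typescript p. 39 L10–L33 (odd),
p. 41 L20–L36 (even): `s = 2k − rank M`.
-/

open Matrix Finset Literature.NumberTheory.EllipticCurves.HeathBrown1994

set_option autoImplicit false

namespace Summit.BirchSwinnertonDyer.Rank1Residual.P2

section Relabel

variable {k : ℕ} (p : Fin k → ℕ) (σ : Fin k ≃ Fin k)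

/-- Monsky's `A` of the relabelled tuple is the reindexed `A`. [cite: HeathBrown1994SelmerCongruentII, Appendix (Monsky), typescript p. 39 L13–L26] -/
theorem legendreMatrix_comp_equiv :
    legendreMatrix (p ∘ σ) = (legendreMatrix p).submatrix σ σ := by
  ext i j
  simp only [legendreMatrix, Matrix.submatrix_apply, Matrix.of_apply, Function.comp_apply]
  by_cases h : i = j
  · subst h
    rw [if_pos rfl, if_pos rfl]
    exact Finset.sum_equiv σ (fun l => by simp [σ.injective.eq_iff]) (fun l _ => rfl)
  · rw [if_neg h, if_neg (σ.injective.ne h)]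

/-- Monsky's diagonal `D_a` of the relabelled tuple is the reindexed `D_a`. [cite: HeathBrown1994SelmerCongruentII, Appendix (Monsky), typescript p. 39 L10–L13] -/
theorem legendreDiagonal_comp_equiv (a : ℤ) :
    legendreDiagonal (p ∘ σ) a = (legendreDiagonal p a).submatrix σ σ := by
  unfold legendreDiagonal
  rw [Matrix.submatrix_diagonal_equiv]
  rfl

/-- A `fromBlocks` matrix reindexed blockwise by `σ ⊕ σ`. [cite: HeathBrown1994SelmerCongruentII, Appendix (Monsky), typescript p. 39 L27–L32] -/
theorem fromBlocks_submatrix_sum_map {α : Type*} (A B C D : Matrix (Fin k) (Fin k) α) :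
    (Matrix.fromBlocks A B C D).submatrix (Sum.map σ σ) (Sum.map σ σ) =
      Matrix.fromBlocks (A.submatrix σ σ) (B.submatrix σ σ) (C.submatrix σ σ) (D.submatrix σ σ) := by
  ext (i | i) (j | j) <;> rfl

/-- **Monsky's EVEN matrix of the relabelled tuple is the reindexed matrix.**
[cite: HeathBrown1994SelmerCongruentII, Appendix (Monsky), typescript p. 41 L20–L36] -/
theorem monskyMatrixEven_comp_equiv :
    monskyMatrixEven (p ∘ σ) = (monskyMatrixEven p).submatrix (Sum.map σ σ) (Sum.map σ σ) := by
  unfold monskyMatrixEven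
  rw [fromBlocks_submatrix_sum_map, legendreMatrix_comp_equiv, legendreDiagonal_comp_equiv,
    legendreDiagonal_comp_equiv]
  rfl

/-- **Monsky's ODD matrix of the relabelled tuple is the reindexed matrix.**
[cite: HeathBrown1994SelmerCongruentII, Appendix (Monsky), typescript p. 39 L27–L32] -/
theorem monskyMatrixOdd_comp_equiv :
    monskyMatrixOdd (p ∘ σ) = (monskyMatrixOdd p).submatrix (Sum.map σ σ) (Sum.map σ σ) := by
  unfold monskyMatrixOdd
  rw [fromBlocks_submatrix_sum_map, legendreMatrix_comp_equiv, legendreDiagonal_comp_equiv,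
    legendreDiagonal_comp_equiv]
  rfl

/-- `Sum.map σ σ` as an equivalence. [cite: HeathBrown1994SelmerCongruentII, Appendix (Monsky), typescript p. 39 L27–L33] -/
theorem sum_map_eq_sumCongr : (Sum.map σ σ : Fin k ⊕ Fin k → Fin k ⊕ Fin k) = ⇑(Equiv.sumCongr σ σ) := rfl

/-- **`s(2m)` is invariant under relabelling the primes**: `monskySelmerRankEven (p ∘ σ) = monskySelmerRankEven p`.
[cite: HeathBrown1994SelmerCongruentII, Appendix (Monsky), typescript p. 41 L36 (s = 2k − rank M)] -/
theorem monskySelmerRankEven_comp_equiv :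
    monskySelmerRankEven (p ∘ σ) = monskySelmerRankEven p := by
  unfold monskySelmerRankEven
  rw [monskyMatrixEven_comp_equiv, sum_map_eq_sumCongr, Matrix.rank_submatrix]

/-- **`s(m)` (odd case) is invariant under relabelling the primes**: `monskySelmerRankOdd (p ∘ σ) = monskySelmerRankOdd p`.
[cite: HeathBrown1994SelmerCongruentII, Appendix (Monsky), typescript p. 39 L33 (s = 2n − rank M)] -/
theorem monskySelmerRankOdd_comp_equiv :
    monskySelmerRankOdd (p ∘ σ) = monskySelmerRankOdd p := by
  unfold monskySelmerRankOdd
  rw [monskyMatrixOdd_comp_equiv, sum_map_eq_sumCongr, Matrix.rank_submatrix]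

/-- The product of the relabelled tuple is the same `n`. [cite: HardyWright2008, §1.3 Thm. 2] -/
theorem prod_comp_equiv : ∏ i, (p ∘ σ) i = ∏ i, p i :=
  Fintype.prod_equiv σ _ _ fun _ => rfl

end Relabel

end Summit.BirchSwinnertonDyer.Rank1Residual.P2
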